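import Literature.AlgebraicGeometry.AbelianSchemes.DualIsogenyDegree
import HarnessLib

/-!
# The kernel count from a points clause: `#Ker q(L) = #K` when «`q P = 1 ↔ P ∈ K`» on `L`-points

Topic `AlgebraicGeometry/AbelianSchemes`, namespace `Literature.AlgebraicGeometry.AbelianSchemes.AbelianSchemeOver`.  THEOREMS ONLY (no definition, no named fact, no
`instance`, no notation, no `sorry`).  Cell `hodgecm-mathlib` (D-0151), F0∕P6 «MOD», line «L2», deal (RK-count) «hcount BRIDGE» (LA2-plan (g2) 2026-09-02T08:47:25Z →
B-p08 (g35)); `--supports stmt-HodgeConjecture-24832`, count-neutral.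

THE POINT.  The roof letters of the cell (`RoofΩ`, clause (r1)) record the kernel of an isogeny `q : A_y → B` of abelian schemes over a field by a POINTS CLAUSE
«`AlgPoints.map q P = 1 ↔ P ∈ K`» for a subgroup `K` of the `L`-points, and the counts of the Hecke roofs are proved for `Nat.card ↥K`; the ★ kernel rows
(`RoofLegsSpecialFibreKernelRowsFin`, row (RK)) speak of `Nat.card (Hom.kerPoints (specOver L L) (homOfIsMonHom q))` (★ `Hom.kerPoints` = the kernel on
`T`-points, [GortzWedhorn2023] (27.1.1): `Ker(f)(T) = Ker(f(T))`).  This file identifies the two: `kerPoints_homOfIsMonHom_eq_of_forall_iff` (the subgroups are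
EQUAL) and `natCard_kerPoints_homOfIsMonHom_eq_of_forall_iff` (hence the counts), so that the (RK) row of a reduced leg reads BY VALUE: with
`Nat.card ↥K = p^{2f}`, `rk Γ(Ker ψ) = p^f · p^f` (`natCard_kerPoints_eq_mul_self_of_forall_iff_of_natCard_eq_pow_two_mul`).

## References
* [GortzWedhorn2023] U. Görtz, T. Wedhorn, *Algebraic Geometry II* (2023) — (27.1.1) (`Ker(f)(T) = Ker(f(T))`).
* [MumfordAV1970] D. Mumford, *Abelian Varieties* (1970) — §4 Cor. 1 (p. 43), §7 Thm. 4 (p. 72).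
-/

set_option autoImplicit false

noncomputable section

universe u

open CategoryTheory CategoryTheory.Limits AlgebraicGeometry MonoidalCategory CartesianMonoidalCategory

namespace Literature.AlgebraicGeometry.AbelianSchemes.AbelianSchemeOver

open Literature.AlgebraicGeometry.Motives Literature.AlgebraicGeometry.Motives.AbelianVariety

variable {k : Type u} [Field k] {A B : AbelianSchemeOver (Spec (CommRingCat.of k))}

/-- **The points clause IS the kernel on `L`-points**: if `q P = 1 ↔ P ∈ K` for all `L`-points `P` of `A`, then `Ker q (L) = K` as subgroups of `A(L)`
(`Hom.mem_kerPoints_iff`; `AlgPoints.map q P = P ≫ q`; `(homOfIsMonHom q).hom.hom.hom = q` by `rfl`). [cite: GortzWedhorn2023, (27.1.1)] [cite: MumfordAV1970, §4 Cor. 1 (p. 43)] -/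
theorem kerPoints_homOfIsMonHom_eq_of_forall_iff (q : A.X ⟶ B.X) [IsMonHom q] {L : Type u} [Field L] [Algebra k L]
    (K : Subgroup (A.toAffine.toAbelianVariety.Points L))
    (h1 : ∀ P : A.toAffine.toAbelianVariety.Points L, (AlgPoints.map q P : B.toAffine.toAbelianVariety.Points L) = 1 ↔ P ∈ K) :
    Hom.kerPoints (specOver k L) (homOfIsMonHom q) = K := by
  ext P
  rw [Hom.mem_kerPoints_iff, homOfIsMonHom_hom, ← h1 P]
  rfl

/-- **`#Ker q(L) = #K`** from the points clause. [cite: GortzWedhorn2023, (27.1.1)] [cite: MumfordAV1970, §7 Thm. 4 (p. 72)] -/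
theorem natCard_kerPoints_homOfIsMonHom_eq_of_forall_iff (q : A.X ⟶ B.X) [IsMonHom q] {L : Type u} [Field L] [Algebra k L]
    (K : Subgroup (A.toAffine.toAbelianVariety.Points L))
    (h1 : ∀ P : A.toAffine.toAbelianVariety.Points L, (AlgPoints.map q P : B.toAffine.toAbelianVariety.Points L) = 1 ↔ P ∈ K) :
    Nat.card ↥(Hom.kerPoints (specOver k L) (homOfIsMonHom q)) = Nat.card ↥K := by
  rw [kerPoints_homOfIsMonHom_eq_of_forall_iff q K h1]

/-- **THE (RK-count) BRIDGE, BY VALUE**: if `q P = 1 ↔ P ∈ K` on `L`-points and `#K = p^{2f}`, then `#Ker q(L) = p^f · p^f` — the shape the L2 (RK) row of the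
cell consumes (`hcount` for ★ `KernelRealisationRank.finrank_alg_realisation_eq_of_finrank_ker_eq` after ★ `RoofLegsSpecialFibreKernelRowsFin` (RK); the
count `#K = p^{2f}` is the cell's roof-kernel count). [cite: GortzWedhorn2023, (27.1.1)] [cite: MumfordAV1970, §7 Thm. 4 (p. 72)] -/
theorem natCard_kerPoints_eq_mul_self_of_forall_iff_of_natCard_eq_pow_two_mul (q : A.X ⟶ B.X) [IsMonHom q] {L : Type u} [Field L] [Algebra k L]
    (K : Subgroup (A.toAffine.toAbelianVariety.Points L))
    (h1 : ∀ P : A.toAffine.toAbelianVariety.Points L, (AlgPoints.map q P : B.toAffine.toAbelianVariety.Points L) = 1 ↔ P ∈ K)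
    {p f : ℕ} (hK : Nat.card ↥K = p ^ (2 * f)) :
    Nat.card ↥(Hom.kerPoints (specOver k L) (homOfIsMonHom q)) = p ^ f * p ^ f := by
  rw [natCard_kerPoints_homOfIsMonHom_eq_of_forall_iff q K h1, hK, two_mul, pow_add]

end Literature.AlgebraicGeometry.AbelianSchemes.AbelianSchemeOver

end
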